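import Summits.CriticalPhenomena.CardyFormulaZ2.Theorems.CardyFlipRussoVoronoiHubFromSmirnovOneArmDefs

/-!
# The mesoscopic scales of the one-arm route — fifth definitions module of line
# `moebius-exact-delaunay-dilation-ward` (crux `VoronoiHubFromSmirnov`, stmt-CriticalPhenomena-6433)

Explicit functions of the mesh `δ` (configuration coordinates) used by the final assembly of the
S3b-i core (lead c3): the no-void radius `rvS δ = 6 √|log δ|` (so that a void has probability
`O(δ^{4π − 2})`), the square side `A · rvS δ`, the two near-tie tolerances `τS`, `τS'` (`∝ δ²`), the
per-square defect probability bound `pS` (the sum of the four landed Poisson bounds, `O(δ² |log δ|⁸)`),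
the global void bound `vS`, the outer arm radius `RS δ = δ^{-1/2}`, the arm factor `BS`, the number
`NS` of squares in range of one square and the number `cardS` of squares of the box, and the final
error `FS = vS + cardS · (3 pS BS + NS pS² BS + NS² pS³)`, which tends to `0` with `δ`.
Nothing but real-valued bookkeeping; no facts asserted.
-/

noncomputable section

namespace Summit.CriticalPhenomena.CardyFormulaZ2.Cruxes.VoronoiHubFromSmirnov.MoebiusExactDelaunayDilationWard

/-- No-void radius at mesh `δ`: `6 √|log δ|` (configuration coordinates). -/
def rvS (δ : ℝ) : ℝ := 6 * Real.sqrt |Real.log δ|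

/-- Near-tie tolerance on the domain side: `W δ² (2 rvS δ)³`. -/
def τS (W δ : ℝ) : ℝ := W * δ ^ 2 * (2 * rvS δ) ^ 3

/-- Near-tie tolerance on the image side: `W' δ² (2 Λ rvS δ)³`. -/
def τS' (W' Λ δ : ℝ) : ℝ := W' * δ ^ 2 * (2 * Λ * rvS δ) ^ 3

/-- Per-square defect probability bound: the four landed Poisson bounds (near-tie / close pair, for
the nuclei and for their transported images) at square side `u = A · rvS δ`. -/
def pS (A W W' Λ m δ : ℝ) : ℝ :=
  (4 * (A * rvS δ + 2 * rvS δ) / τS W δ + 1) ^ 2 * (4 * (2 * rvS δ) / τS W δ) *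
      ((36 * Real.pi * 2 * τS W δ * (2 * rvS δ)) ^ 4 / 24) +
    (4 * (A * rvS δ + 6 * rvS δ) / τS W δ + 1) ^ 2 * ((2 * Real.pi * (2 * τS W δ) ^ 2) ^ 2 / 2) +
    (4 * (Λ * (A * rvS δ) + 2 * Λ * rvS δ) / τS' W' Λ δ + 1) ^ 2 * (4 * (2 * Λ * rvS δ) / τS' W' Λ δ) *
      ((36 * Real.pi * (2 / m ^ 2) * τS' W' Λ δ * (2 * Λ * rvS δ)) ^ 4 / 24) +
    (4 * (Λ * (A * rvS δ) + 3 * (2 * Λ * rvS δ)) / τS' W' Λ δ + 1) ^ 2 *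
      (((2 / m ^ 2) * Real.pi * (2 * τS' W' Λ δ) ^ 2) ^ 2 / 2)

/-- Global void probability bound at mesh `δ` for a window inside `closedBall 0 ρ₀`. -/
def vS (ρ₀ δ : ℝ) : ℝ :=
  (12 * (ρ₀ / δ) / rvS δ + 1) ^ 2 * Real.exp (-(Real.pi * (rvS δ / 3) ^ 2))

/-- Outer arm radius `δ^{-1/2}` (configuration coordinates). -/
def RS (δ : ℝ) : ℝ := (Real.sqrt δ)⁻¹

/-- The arm factor of one step: `(Ca + v + 1)² ((400 u / R)^η + v)`. -/
def BS (A Ca ηa ρ₀ δ : ℝ) : ℝ :=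
  (Ca + vS ρ₀ δ + 1) ^ 2 * ((400 * (A * rvS δ) / RS δ) ^ ηa + vS ρ₀ δ)

/-- Number of squares within range of a given square: `(2 (R + 2u)/u + 1)²`. -/
def NS (A δ : ℝ) : ℝ := (2 * (RS δ + 2 * (A * rvS δ)) / (A * rvS δ) + 1) ^ 2

/-- Half-width of the box of squares covering a window inside `closedBall 0 ρ₀`. -/
def MS (ρ₀ A δ : ℝ) : ℕ := ⌈ρ₀ / (δ * (A * rvS δ))⌉₊

/-- Number of squares of the box: `(2 M + 1)²`. -/
def cardS (ρ₀ A δ : ℝ) : ℝ := ((2 * MS ρ₀ A δ + 1 : ℕ) : ℝ) ^ 2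

/-- The final error of the one-arm route at mesh `δ`. -/
def FS (A W W' Λ m Ca ηa ρ₀ δ : ℝ) : ℝ :=
  vS ρ₀ δ + cardS ρ₀ A δ * (3 * pS A W W' Λ m δ * BS A Ca ηa ρ₀ δ +
    NS A δ * pS A W W' Λ m δ ^ 2 * BS A Ca ηa ρ₀ δ + NS A δ ^ 2 * pS A W W' Λ m δ ^ 3)

/-- Registered glue sub-goal of this module: the no-void radius is nonnegative. -/
theorem rvS_nonneg : ∀ δ : ℝ, 0 ≤ rvS δ := fun δ => by
  unfold rvS; positivity

end Summit.CriticalPhenomena.CardyFormulaZ2.Cruxes.VoronoiHubFromSmirnov.MoebiusExactDelaunayDilationWard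

end
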